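import Literature.NumberTheory.LFunctions.RudnickSarnakCycles
import Literature.Combinatorics.Enumerative.SpitzerIdentity
import HarnessLib

/-!
# Rudnick–Sarnak Proposition 4.3: the per-block identity

Z. Rudnick, P. Sarnak, Duke Math. J. **81** (1996), pp. 311–315. For `u ∈ ℝⁿ` with
`∑ u_j = 0` and an ordering `O` of `N = {1, …, n}`, `V(O) = M_u(O) - m_u(O)` is the spread of
the consecutive partial sums (4.29)–(4.31); it is invariant under rotations of `O` (p. 312), and
`T(u) = ∑'_O V(O)` ((4.33)), the sum over orderings modulo rotations, i.e. over the cyclic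
permutations of `N`. Proposition 4.3 (`X_S = (-1)^{|S|-1} Y_S` on `∑ |u_j| < 2`) is, by
Lemma 4.3 and (4.34), the identity (4.35) `T(u) = ∑_{[F, Fᶜ]} (|F|-1)! (n-|F|-1)! |u_F|`, proved
on pp. 312–315 from Spitzer's combinatorial lemma. Here:

* `cycSpread τ b ℓ u` — `V(O)` for the ordering `O = (τ b, τ² b, …, τ^ℓ b)` of the orbit of `b`;
  `spreadFn_comp_finRotate_pow` — rotation invariance; `cycSpread_eq_of_mem` — hence
  independence of the base point `b` on the block.
* `sum_cyc_cycSpread` — `∑_{τ ∈ S*(C)} V_τ(u) = ½ ∑_{A ⊆ C} (|A|-1)!(|C|-|A|-1)! |u_A|` ((4.35),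
  from `Literature.Combinatorics.Enumerative.sum_perm_spread_eq`).
* **`sum_cyc_sign_mul_one_sub_cycSpread`** — the per-block identity in the form consumed by the
  proof of Theorem 4.1:
  `∑_{τ ∈ S*(C)} sign τ (1 - V_τ(u)) = μ_C + ∑_{∅ ≠ A ⊆ C ∖ {a₀}} μ_A μ_{C∖A} |u_A|`,
  `μ_t = (-1)^{|t|-1}(|t|-1)!` (`blockMoebius`): the left side is the density of
  `(-1)^{|C|-1} Y_C` (Lemma 4.3: `∫ Ω(v)Ω(v+s₁)⋯ dv = 1 - V`), the right side that of `X_C`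
  ((4.18) with (4.25)).

## References

* Z. Rudnick, P. Sarnak, Duke Math. J. 81 (1996), (4.18), (4.25), (4.29)–(4.43), Lemma 4.3,
  Prop. 4.3.
* F. Spitzer, Trans. AMS 82 (1956), Thm 2.2.
-/

noncomputable section

open Finset Equiv Equiv.Perm
open Literature.Combinatorics.Enumerative Literature.Combinatorics.Enumerative.Spitzer

namespace Literature.NumberTheory.LFunctions

namespace RudnickSarnak

/-! ## The spread of a walk and its rotation invariance -/

/-- The spread `V = max_t s_t - min_t s_t = max_t s_t + max_t (-s_t)` of the walk with steps
`y_0, …, y_{ℓ-1}` (RS (4.31): `V(O) = M_u(O) - m_u(O)`; the empty partial sum `s_0 = 0` is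
included, which is harmless for zero-sum steps). [cite: RudnickSarnak1996, (4.31)] -/
def spreadFn {ℓ : ℕ} (y : Fin ℓ → ℝ) : ℝ := maxPre y + maxPre (-y)

/-- The spread `V_{τ, b}(u)` of `u` along the orbit of `b` under `τ`, read from `τ b`:
`spreadFn (u(τ b), u(τ² b), …, u(τ^ℓ b))` (RS's `V(O)` for this ordering `O` of the block).
[cite: RudnickSarnak1996, (4.29)–(4.31)] -/
def cycSpread {α : Type*} (τ : Perm α) (b : α) (ℓ : ℕ) (u : α → ℝ) : ℝ :=
  spreadFn (u ∘ orbitSeq τ b ℓ)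

section prefixSums

variable {n : ℕ}

/-- `S(x) ≥ 0` (the empty prefix). [folklore] -/
theorem maxPre_nonneg (x : Fin n → ℝ) : 0 ≤ maxPre x := by
  unfold maxPre
  have h0 : preSum x 0 = 0 := by simp [preSum]
  rw [← h0]
  exact Finset.le_sup' (preSum x) (by simp)

/-- `S(x) ≥ ∑ x` (the full prefix). [folklore] -/
theorem sum_le_maxPre (x : Fin n → ℝ) : ∑ i, x i ≤ maxPre x := by
  unfold maxPre
  have hn : preSum x n = ∑ i, x i := by
    unfold preSum
    congr 1
    ext i
    simp
  rw [← hn]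
  exact Finset.le_sup' (preSum x) (by simp)

/-- Prefix sums of `(a, v)`: `s_{t+1}(a, v) = a + s_t(v)`. [folklore] -/
theorem preSum_cons_succ (a : ℝ) (v : Fin n → ℝ) (t : ℕ) :
    preSum (Fin.cons a v : Fin (n + 1) → ℝ) (t + 1) = a + preSum v t := by
  unfold preSum
  rw [Finset.sum_filter, Finset.sum_filter, Fin.sum_univ_succ]
  simp

/-- `s_0 = 0`. [folklore] -/
theorem preSum_zero (x : Fin n → ℝ) : preSum x 0 = 0 := by simp [preSum]

/-- Prefix sums of `(v, a)`: `s_t(v, a) = s_t(v)` for `t ≤ n`. [folklore] -/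
theorem preSum_snoc_of_le (v : Fin n → ℝ) (a : ℝ) {t : ℕ} (ht : t ≤ n) :
    preSum (Fin.snoc v a : Fin (n + 1) → ℝ) t = preSum v t := by
  unfold preSum
  rw [Finset.sum_filter, Finset.sum_filter, Fin.sum_univ_castSucc]
  simp only [Fin.snoc_castSucc, Fin.val_castSucc, Fin.snoc_last, Fin.val_last]
  rw [if_neg (by omega), add_zero]

/-- `s_{n+1}(v, a) = ∑ v + a`. [folklore] -/
theorem preSum_snoc_last (v : Fin n → ℝ) (a : ℝ) :
    preSum (Fin.snoc v a : Fin (n + 1) → ℝ) (n + 1) = ∑ i, v i + a := by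
  unfold preSum
  have : univ.filter (fun i : Fin (n + 1) ↦ (i : ℕ) < n + 1) = univ := by
    ext i
    simp only [Finset.mem_filter, Finset.mem_univ, true_and, iff_true]
    exact i.isLt
  rw [this, Fin.sum_univ_castSucc]
  simp

/-- `S(a, v) = max(0, a + S(v))`. [folklore] -/
theorem maxPre_cons (a : ℝ) (v : Fin n → ℝ) :
    maxPre (Fin.cons a v : Fin (n + 1) → ℝ) = max 0 (a + maxPre v) := by
  refine le_antisymm ?_ ?_
  · unfold maxPre
    refine Finset.sup'_le _ _ fun t ht ↦ ?_
    rcases t with _ | t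
    · rw [preSum_zero]
      exact le_max_left _ _
    · rw [preSum_cons_succ]
      have hmem : t ∈ range (n + 1) := by
        simp only [Finset.mem_range] at ht ⊢
        omega
      have := Finset.le_sup' (preSum v) hmem
      exact le_max_of_le_right (by linarith)
  · refine max_le (maxPre_nonneg _) ?_
    unfold maxPre
    obtain ⟨t, ht, heq⟩ := Finset.exists_mem_eq_sup' (s := range (n + 1)) ⟨0, by simp⟩ (preSum v)
    rw [heq, ← preSum_cons_succ]
    refine Finset.le_sup' (preSum (Fin.cons a v : Fin (n + 1) → ℝ)) ?_
    simp only [Finset.mem_range] at ht ⊢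
    omega

/-- `S(v, a) = max(S(v), ∑ v + a)`. [folklore] -/
theorem maxPre_snoc (v : Fin n → ℝ) (a : ℝ) :
    maxPre (Fin.snoc v a : Fin (n + 1) → ℝ) = max (maxPre v) (∑ i, v i + a) := by
  refine le_antisymm ?_ ?_
  · unfold maxPre
    refine Finset.sup'_le _ _ fun t ht ↦ ?_
    simp only [Finset.mem_range] at ht
    rcases Nat.lt_or_ge t (n + 1) with h | h
    · rw [preSum_snoc_of_le v a (by omega)]
      exact (Finset.le_sup' (preSum v) (by simp [Finset.mem_range]; omega)).trans (le_max_left _ _)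
    · have : t = n + 1 := by omega
      subst this
      rw [preSum_snoc_last]
      exact le_max_right _ _
  · refine max_le ?_ ?_
    · unfold maxPre
      refine Finset.sup'_le _ _ fun t ht ↦ ?_
      simp only [Finset.mem_range] at ht
      rw [← preSum_snoc_of_le v a (by omega)]
      exact Finset.le_sup' (preSum (Fin.snoc v a : Fin (n + 1) → ℝ))
        (by simp [Finset.mem_range]; omega)
    · unfold maxPre
      rw [← preSum_snoc_last]
      exact Finset.le_sup' (preSum (Fin.snoc v a : Fin (n + 1) → ℝ)) (by simp)

/-- Negation commutes with `cons`. [folklore] -/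
theorem neg_cons (a : ℝ) (v : Fin n → ℝ) :
    -(Fin.cons a v : Fin (n + 1) → ℝ) = Fin.cons (-a) (-v) := by
  funext j
  refine Fin.cases ?_ (fun i ↦ ?_) j <;> simp

/-- Negation commutes with `snoc`. [folklore] -/
theorem neg_snoc (v : Fin n → ℝ) (a : ℝ) :
    -(Fin.snoc v a : Fin (n + 1) → ℝ) = Fin.snoc (-v) (-a) := by
  funext j
  refine Fin.lastCases ?_ (fun i ↦ ?_) j <;> simp

/-- **Rotation invariance of the spread** (RS p. 312: "`V(O) = V(O')` if `O'` is a rotation of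
`O`"), for zero-sum steps: moving the first step to the end translates the walk.
[cite: RudnickSarnak1996, (4.31)] -/
theorem spreadFn_comp_finRotate (y : Fin (n + 1) → ℝ) (hy : ∑ i, y i = 0) :
    spreadFn (y ∘ finRotate (n + 1)) = spreadFn y := by
  -- `y = (a, v)` and `y ∘ rot = (v, a)`
  set a := y 0 with ha
  set v : Fin n → ℝ := Fin.tail y with hv
  have hy' : y = Fin.cons a v := (Fin.cons_self_tail y).symm
  have hrot : y ∘ finRotate (n + 1) = Fin.snoc v a := by
    rw [hy', Fin.snoc_eq_cons_rotate]
    rfl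
  have hsum : a + ∑ i, v i = 0 := by rw [hy', Fin.sum_cons] at hy; exact hy
  rw [hrot, hy', spreadFn, spreadFn, neg_cons, neg_snoc, maxPre_cons, maxPre_snoc, maxPre_cons,
    maxPre_snoc]
  have h1 : 0 ≤ a + maxPre v := by linarith [sum_le_maxPre v]
  have h2 : 0 ≤ -a + maxPre (-v) := by
    have := sum_le_maxPre (-v)
    simp only [Pi.neg_apply, Finset.sum_neg_distrib] at this
    linarith
  have h3 : ∑ i, v i + a ≤ maxPre v := by linarith [maxPre_nonneg v]
  have h4 : ∑ i, (-v) i + -a ≤ maxPre (-v) := by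
    simp only [Pi.neg_apply, Finset.sum_neg_distrib]
    linarith [maxPre_nonneg (-v)]
  rw [max_eq_right h1, max_eq_right h2, max_eq_left h3, max_eq_left h4]
  ring

/-- Rotation invariance, iterated. [cite: RudnickSarnak1996, (4.31)] -/
theorem spreadFn_comp_finRotate_pow (m : ℕ) :
    ∀ y : Fin (n + 1) → ℝ, ∑ i, y i = 0 → spreadFn (y ∘ ⇑(finRotate (n + 1) ^ m)) = spreadFn y := by
  induction m with
  | zero =>
    intro y _
    simp
  | succ m ih =>
    intro y hy
    have : y ∘ ⇑(finRotate (n + 1) ^ (m + 1)) =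
        (y ∘ finRotate (n + 1)) ∘ ⇑(finRotate (n + 1) ^ m) := by
      rw [pow_succ']
      rfl
    rw [this, ih (y ∘ finRotate (n + 1)) ?_, spreadFn_comp_finRotate y hy]
    rw [Function.comp_def, Equiv.sum_comp (finRotate (n + 1)) y]
    exact hy

/-- The rotation shifts values by one, modulo `n + 1`. [folklore] -/
theorem val_finRotate_modEq (i : Fin (n + 1)) : ((finRotate (n + 1) i : ℕ)) ≡ i + 1 [MOD n + 1] := by
  rcases eq_or_ne i (Fin.last n) with rfl | hi
  · rw [finRotate_last, Fin.val_zero, Fin.val_last]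
    simp [Nat.ModEq]
  · rw [coe_finRotate_of_ne_last hi]

/-- Powers of the rotation shift values by `m`, modulo `n + 1`. [folklore] -/
theorem val_finRotate_pow_modEq (m : ℕ) (t : Fin (n + 1)) :
    (((finRotate (n + 1) ^ m) t : ℕ)) ≡ t + m [MOD n + 1] := by
  induction m with
  | zero => simp [Nat.ModEq.refl]
  | succ m ih =>
    rw [pow_succ', Perm.mul_apply, ← add_assoc]
    exact (val_finRotate_modEq _).trans (ih.add_right 1)

end prefixSums

/-! ## Base-point independence on a block -/

section block

variable {α : Type*} [Fintype α] [DecidableEq α] {n : ℕ} {C : Finset α} (hC : #C = n + 1)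
include hC

/-- Changing the base point along the orbit rotates the orbit sequence. [folklore] -/
theorem orbitSeq_pow_apply {τ : Perm α} (hτ : τ ∈ fib {C}) {a : α} (ha : a ∈ C) (m : ℕ) :
    orbitSeq τ ((τ ^ m) a) (n + 1) = orbitSeq τ a (n + 1) ∘ ⇑(finRotate (n + 1) ^ m) := by
  funext t
  simp only [orbitSeq, Function.comp_apply]
  rw [← Perm.mul_apply, ← pow_add]
  refine ((mem_cyc.1 hτ).1.pow_apply_eq_pow_apply ha).2 ?_
  rw [hC]
  have h := (val_finRotate_pow_modEq m t).add_right 1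
  have : (t : ℕ) + 1 + m = t + m + 1 := by ring
  rw [this]
  exact h.symm

/-- Summing along an ordering of `C` is summing over `C`. [folklore] -/
theorem sum_comp_of_mem_linOrders {e : Fin (n + 1) → α} (he : e ∈ linOrders C (n + 1))
    (u : α → ℝ) : ∑ t, u (e t) = ∑ c ∈ C, u c := by
  rw [mem_linOrders] at he
  rw [← Finset.sum_image (f := u) (s := univ) (g := e) (fun x _ y _ h ↦ he.1 h)]
  congr 1
  refine Finset.eq_of_subset_of_card_le (fun c hc ↦ ?_) ?_
  · obtain ⟨t, -, rfl⟩ := Finset.mem_image.1 hc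
    exact he.2 t
  · rw [Finset.card_image_of_injective _ he.1, card_univ, Fintype.card_fin, hC]

/-- **Independence of the base point** (RS p. 312, `V(O) = V(O')` for rotations): along a
block on which `u` sums to zero, the spread of `u` on the orbit does not depend on where the
orbit is started. [cite: RudnickSarnak1996, (4.31)] -/
theorem cycSpread_eq_of_mem {τ : Perm α} (hτ : τ ∈ fib {C}) {a b : α} (ha : a ∈ C) (hb : b ∈ C)
    (u : α → ℝ) (hu : ∑ c ∈ C, u c = 0) :
    cycSpread τ b (n + 1) u = cycSpread τ a (n + 1) u := by
  obtain ⟨m, -, rfl⟩ := (mem_cyc.1 hτ).1.exists_pow_eq ha hb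
  unfold cycSpread
  rw [orbitSeq_pow_apply hC hτ ha m, ← Function.comp_assoc]
  refine spreadFn_comp_finRotate_pow m (u ∘ orbitSeq τ a (n + 1)) ?_
  have := sum_comp_of_mem_linOrders hC (orbitSeq_mem_linOrders hC hτ ha) u
  simp only [Function.comp_apply]
  rw [this, hu]

/-! ## (4.35): the sum of the spreads over the cyclic permutations -/

omit [Fintype α] [DecidableEq α] hC in
/-- Spitzer's weight `(|A|-1)! (n-|A|)!` for subsets of a block of size `n + 1`. [folklore] -/
theorem weight_eq (A : Finset (Fin (n + 1))) :
    (((#A - 1).factorial * (n + 1 - #A - 1).factorial : ℕ) : ℝ) =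
      (((#A - 1).factorial * (n - #A).factorial : ℕ) : ℝ) := by
  have : n + 1 - #A - 1 = n - #A := by omega
  rw [this]

/-- **RS (4.35) on a block** (from Spitzer's lemma, `sum_perm_spread_eq`, via
"orderings modulo rotations" `sum_cyc_sum_eq_sum_perm` and base-point independence): for a
block `C` of size `n + 1`, `a₀ ∈ C` and `u` with `∑_C u = 0`,
`∑_{τ ∈ S*(C)} V_τ(u) = ½ ∑_{A ⊆ C} (|A|-1)! (n-|A|)! |u_A|` (`= T(u)` of (4.33), (4.35)/(4.43) with
the unordered pairs `{F, Fᶜ}` written as half the sum over all subsets).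
[cite: RudnickSarnak1996, (4.33)–(4.35)] -/
theorem sum_cyc_cycSpread {a₀ : α} (ha₀ : a₀ ∈ C) (u : α → ℝ) (hu : ∑ c ∈ C, u c = 0) :
    ∑ τ ∈ fib {C}, cycSpread τ a₀ (n + 1) u =
      (1 / 2 : ℝ) * ∑ A ∈ C.powerset,
        (((#A - 1).factorial * (n - #A).factorial : ℕ) : ℝ) * |∑ i ∈ A, u i| := by
  obtain ⟨e₀, he₀⟩ := exists_linOrder hC
  -- `(n+1) · ∑_τ V_τ = ∑_τ ∑_b V_{τ,b} = ∑_σ V(u ∘ e₀ ∘ σ)`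
  have h1 : ((n + 1 : ℕ) : ℝ) * ∑ τ ∈ fib {C}, cycSpread τ a₀ (n + 1) u =
      ∑ τ ∈ fib {C}, ∑ b ∈ C, cycSpread τ b (n + 1) u := by
    rw [Finset.mul_sum]
    refine Finset.sum_congr rfl fun τ hτ ↦ ?_
    rw [Finset.sum_congr rfl (fun b hb ↦ cycSpread_eq_of_mem hC hτ ha₀ hb u hu), Finset.sum_const,
      hC, nsmul_eq_mul]
  have h2 : ∑ τ ∈ fib {C}, ∑ b ∈ C, cycSpread τ b (n + 1) u =
      ∑ σ : Perm (Fin (n + 1)), spreadFn ((u ∘ e₀) ∘ σ) :=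
    sum_cyc_sum_eq_sum_perm hC (fun e ↦ spreadFn (u ∘ e)) e₀ he₀
  have hsum0 : ∑ i, (u ∘ e₀) i = 0 := by
    have he₀' : e₀ ∈ linOrders C (n + 1) := mem_linOrders.2 he₀
    simp only [Function.comp_apply]
    rw [sum_comp_of_mem_linOrders hC he₀' u, hu]
  have h3 : ∑ σ : Perm (Fin (n + 1)), spreadFn ((u ∘ e₀) ∘ σ) =
      ((n + 1 : ℕ) : ℝ) / 2 * ∑ A : Finset (Fin (n + 1)),
        (((#A - 1).factorial * (n - #A).factorial : ℕ) : ℝ) * |∑ i ∈ A, (u ∘ e₀) i| := by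
    have := sum_perm_spread_eq (u ∘ e₀) hsum0
    simp only [spreadFn]
    rw [show ∑ σ : Perm (Fin (n + 1)), (maxPre ((u ∘ e₀) ∘ ⇑σ) + maxPre (-((u ∘ e₀) ∘ ⇑σ))) =
      ∑ σ : Perm (Fin (n + 1)), (maxPre ((u ∘ e₀) ∘ ⇑σ) + maxPre ((-(u ∘ e₀)) ∘ ⇑σ)) from rfl, this]
    congr 1
    exact Finset.sum_congr rfl fun A _ ↦ by rw [weight_eq]
  -- transport the subsets of `Fin (n+1)` to the subsets of `C`
  have h4 : ∑ A : Finset (Fin (n + 1)),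
      (((#A - 1).factorial * (n - #A).factorial : ℕ) : ℝ) * |∑ i ∈ A, (u ∘ e₀) i| =
        ∑ A ∈ C.powerset, (((#A - 1).factorial * (n - #A).factorial : ℕ) : ℝ) * |∑ i ∈ A, u i| := by
    set f : Fin (n + 1) ↪ α := ⟨e₀, he₀.1⟩ with hf
    have hC' : C = (univ : Finset (Fin (n + 1))).map f := by
      refine (Finset.eq_of_subset_of_card_le (fun c hc ↦ ?_) ?_).symm
      · obtain ⟨t, -, rfl⟩ := Finset.mem_map.1 hc
        exact he₀.2 t
      · rw [Finset.card_map, card_univ, Fintype.card_fin, hC]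
    have huniv : (univ : Finset (Finset (Fin (n + 1)))) = (univ : Finset (Fin (n + 1))).powerset := by
      ext A; simp
    rw [hC', Spitzer.sum_powerset_map, huniv]
    refine Finset.sum_congr rfl fun A _ ↦ ?_
    rw [Finset.card_map, Finset.sum_map]
    rfl
  have key : ((n + 1 : ℕ) : ℝ) * ∑ τ ∈ fib {C}, cycSpread τ a₀ (n + 1) u =
      ((n + 1 : ℕ) : ℝ) * ((1 / 2 : ℝ) * ∑ A ∈ C.powerset,
        (((#A - 1).factorial * (n - #A).factorial : ℕ) : ℝ) * |∑ i ∈ A, u i|) := by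
    rw [h1, h2, h3, h4]
    ring
  exact mul_left_cancel₀ (by positivity) key

/-! ## The per-block identity (Proposition 4.3) -/

omit [Fintype α] in
/-- Pairing `A ↔ C ∖ A`: `∑_{A ⊆ C} (|A|-1)!(n-|A|)! |u_A| = 2 ∑_{A ⊆ C ∖ {a₀}} (|A|-1)!(n-|A|)! |u_A|`
when `∑_C u = 0` ((4.42): "grouping together the terms corresponding to `F₁` and its
complement"). [cite: RudnickSarnak1996, (4.42)] -/
theorem sum_powerset_weight_abs {a₀ : α} (ha₀ : a₀ ∈ C) (u : α → ℝ) (hu : ∑ c ∈ C, u c = 0) :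
    ∑ A ∈ C.powerset, (((#A - 1).factorial * (n - #A).factorial : ℕ) : ℝ) * |∑ i ∈ A, u i| =
      2 * ∑ A ∈ (C.erase a₀).powerset,
        (((#A - 1).factorial * (n - #A).factorial : ℕ) : ℝ) * |∑ i ∈ A, u i| := by
  set S := C.erase a₀ with hS
  set g : Finset α → ℝ :=
    fun A ↦ (((#A - 1).factorial * (n - #A).factorial : ℕ) : ℝ) * |∑ i ∈ A, u i| with hg
  have hCS : C = insert a₀ S := (Finset.insert_erase ha₀).symm
  have ha₀S : a₀ ∉ S := Finset.notMem_erase a₀ C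
  have hcardS : #S = n := by rw [hS, Finset.card_erase_of_mem ha₀, hC]; rfl
  have huS : ∑ i ∈ S, u i = -u a₀ := by
    rw [hS, Finset.sum_erase_eq_sub ha₀, hu, zero_sub]
  rw [hCS, Finset.sum_powerset_insert ha₀S, two_mul]
  congr 1
  -- `g (insert a₀ A) = g (S ∖ A)` and the involution `A ↦ S ∖ A`
  have hstep : ∀ A ∈ S.powerset, g (insert a₀ A) = g (S \ A) := by
    intro A hA
    have hAS : A ⊆ S := Finset.mem_powerset.1 hA
    have ha₀A : a₀ ∉ A := fun h ↦ ha₀S (hAS h)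
    have hcardA : #A ≤ n := hcardS ▸ Finset.card_le_card hAS
    simp only [hg]
    rw [Finset.card_insert_of_notMem ha₀A, Finset.card_sdiff_of_subset hAS, hcardS,
      Finset.sum_insert ha₀A, Finset.sum_sdiff_eq_sub hAS, huS]
    congr 1
    · congr 1
      rw [mul_comm]
      congr 2
      omega
    · rw [show -u a₀ - ∑ x ∈ A, u x = -(u a₀ + ∑ x ∈ A, u x) by ring, abs_neg]
  rw [Finset.sum_congr rfl hstep]
  refine Finset.sum_nbij' (S \ ·) (S \ ·) ?_ ?_ ?_ ?_ (fun _ _ ↦ rfl)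
  · intro A _
    exact Finset.mem_powerset.2 Finset.sdiff_subset
  · intro A _
    exact Finset.mem_powerset.2 Finset.sdiff_subset
  · intro A hA
    exact Finset.sdiff_sdiff_eq_self (Finset.mem_powerset.1 hA)
  · intro A hA
    exact Finset.sdiff_sdiff_eq_self (Finset.mem_powerset.1 hA)

/-- **Rudnick–Sarnak Proposition 4.3, per block, in density form.** For a block `C` of size
`n + 1` with base point `a₀ ∈ C` and `u` summing to zero on `C`:
`∑_{τ ∈ S*(C)} sign τ · (1 - V_τ(u)) = μ_C + ∑_{∅ ≠ A ⊆ C ∖ {a₀}} μ_A μ_{C∖A} |u_A|`,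
`μ_t = (-1)^{|t|-1} (|t|-1)!`. By Lemma 4.3 (`∫ Ω(v)Ω(v+s₁)⋯Ω(v+s₁+⋯+s_{n}) dv = 1 - V` for
`∑ u_j = 0`, `∑ |u_j| < 2`) and (4.34) the left side is the density of `(-1)^{|C|-1} Y_C(u)`
((4.20)) on the stratum of `C`; by (4.18) and the factorisation (4.25) the right side is that
of `X_C(u)`; their equality is Proposition 4.3, i.e. (4.35), here obtained from
`sum_cyc_cycSpread` and the pairing `A ↔ C ∖ A`. (No support condition is needed for the
identity itself; `∑ |u_j| < 2` only serves to remove the positive part in Lemma 4.3.)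
[cite: RudnickSarnak1996, Prop 4.3] -/
theorem sum_cyc_sign_mul_one_sub_cycSpread {a₀ : α} (ha₀ : a₀ ∈ C) (u : α → ℝ)
    (hu : ∑ c ∈ C, u c = 0) :
    ∑ τ ∈ fib {C}, ((Equiv.Perm.sign τ : ℤ) : ℝ) * (1 - cycSpread τ a₀ (n + 1) u) =
      (blockMoebius C : ℝ) + ∑ A ∈ (C.erase a₀).powerset with A.Nonempty,
        ((blockMoebius A * blockMoebius (C \ A) : ℤ) : ℝ) * |∑ i ∈ A, u i| := by
  set S := C.erase a₀ with hS
  set w : Finset α → ℝ := fun A ↦ (((#A - 1).factorial * (n - #A).factorial : ℕ) : ℝ) with hw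
  have ha₀S : a₀ ∉ S := Finset.notMem_erase a₀ C
  have hcardS : #S = n := by rw [hS, Finset.card_erase_of_mem ha₀, hC]; rfl
  -- left side: `(-1)^n (n! - ∑_τ V_τ)`
  have hL : ∑ τ ∈ fib {C}, ((Equiv.Perm.sign τ : ℤ) : ℝ) * (1 - cycSpread τ a₀ (n + 1) u) =
      (-1) ^ n * (n.factorial - ∑ A ∈ S.powerset, w A * |∑ i ∈ A, u i|) := by
    have hsign : ∀ τ ∈ fib {C}, ((Equiv.Perm.sign τ : ℤ) : ℝ) = (-1) ^ n := by
      intro τ hτ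
      rw [sign_of_mem_cyc hC hτ]
      push_cast
      rfl
    rw [Finset.sum_congr rfl (fun τ hτ ↦ by rw [hsign τ hτ]), ← Finset.mul_sum, Finset.sum_sub_distrib,
      Finset.sum_const, card_cyc hC, nsmul_eq_mul, mul_one, sum_cyc_cycSpread hC ha₀ u hu,
      sum_powerset_weight_abs hC ha₀ u hu]
    ring
  -- right side: `μ_C = (-1)^n n!` and `μ_A μ_{C∖A} = -(-1)^n w(A)` for `∅ ≠ A ⊆ S`
  have hμC : (blockMoebius C : ℝ) = (-1) ^ n * n.factorial := by
    rw [blockMoebius, hC]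
    push_cast
    simp
  have hμA : ∀ A ∈ S.powerset.filter (fun A ↦ A.Nonempty),
      ((blockMoebius A * blockMoebius (C \ A) : ℤ) : ℝ) * |∑ i ∈ A, u i| =
        -((-1) ^ n * (w A * |∑ i ∈ A, u i|)) := by
    intro A hA
    obtain ⟨hA, hne⟩ := Finset.mem_filter.1 hA
    have hAS : A ⊆ S := Finset.mem_powerset.1 hA
    have hAC : A ⊆ C := hAS.trans (Finset.erase_subset a₀ C)
    have hpos : 1 ≤ #A := Finset.card_pos.2 hne
    have hle : #A ≤ n := hcardS ▸ Finset.card_le_card hAS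
    rw [blockMoebius, blockMoebius, Finset.card_sdiff_of_subset hAC, hC, hw]
    have h1 : n + 1 - #A - 1 = n - #A := by omega
    rw [h1]
    push_cast
    have hsgn : ((-1 : ℝ) ^ (#A - 1)) * (-1) ^ (n - #A) = -(-1) ^ n := by
      rw [← pow_add]
      have h2 : #A - 1 + (n - #A) = n - 1 := by omega
      obtain ⟨m, rfl⟩ : ∃ m, n = m + 1 := ⟨n - 1, by omega⟩
      rw [h2, pow_succ]
      simp
    linear_combination ((#A - 1).factorial : ℝ) * ((n - #A).factorial : ℝ) * |∑ i ∈ A, u i| * hsgn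
  rw [hL, hμC, Finset.sum_congr rfl hμA, Finset.sum_neg_distrib, ← Finset.mul_sum]
  -- the empty set contributes nothing to `∑_{A ⊆ S} w(A) |u_A|`
  have hsplit : ∑ A ∈ S.powerset, w A * |∑ i ∈ A, u i| =
      ∑ A ∈ S.powerset.filter (fun A ↦ A.Nonempty), w A * |∑ i ∈ A, u i| := by
    rw [← Finset.sum_filter_add_sum_filter_not S.powerset (fun A ↦ A.Nonempty)]
    rw [Finset.sum_eq_zero (s := S.powerset.filter (fun A ↦ ¬A.Nonempty)), add_zero]
    intro A hA
    obtain ⟨-, hne⟩ := Finset.mem_filter.1 hA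
    rw [Finset.not_nonempty_iff_eq_empty.1 hne]
    simp
  rw [hsplit]
  ring

end block



end RudnickSarnak

end Literature.NumberTheory.LFunctions

end
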